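import Summits.BirchSwinnertonDyer.BirchSwinnertonDyer.Theorems.InertBadSignedBranchesCccOneLawOnTypeIstarZeroTwistPeriodLattice
import Summits.BirchSwinnertonDyer.Rank1Residual.X11b.BDPRouteManin
import Literature.NumberTheory.EllipticCurves.RootNumberTwistProofs
import Literature.NumberTheory.EllipticCurves.TwistRootNumberModularityProofs
import Literature.NumberTheory.EllipticCurves.PAdicGrossZagierConstantTermProofs
import Literature.NumberTheory.EllipticCurves.NeronIsogenyScalingHoldsProofs
import Literature.NumberTheory.EllipticCurves.NonEisensteinPrimeOfSurjective
import Literature.NumberTheory.EllipticCurves.EichlerShimuraConstructionProofs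
import Literature.NumberTheory.EllipticCurves.Rank1Residual.GVParityTwistTransportProofs
import HarnessLib

/-!
# Route `InertBadSignedBranches` (rung K8), crux `CccOneLawOnTypeIstarZero` (stmt-…-19223), stub U:
# THE MANIN CONSTANT OF A `p*`-TWIST CLASS IS PRIME TO `p` — `∃` a modular parametrisation of `W`
# with `p ∤ c` whenever `W^{(p*)}` is good at the odd prime `p` and `W[p]` is irreducible
# (helper toward stmt-BirchSwinnertonDyer-19223; cell bsd-cm, seat bsd-cm-k8i-c2 g6; second of three
# files `…TwistPeriodLattice` → `…ManinTwist` → `…ManinTwistOnType`)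

THE GAP. The registered skeleton of the crux (A12: stubs NV / U / L) reads, modulo the route's support
items: NV holds; L ⟺ `X12.O10.LowerHalfOnType p I₀*` (STEP L, no source); U ⟺ the Kolyvagin upper
half on the type — PUBLISHED at `p ≥ 11` only, because the tree's every-curve Kolyvagin half
(`X12.missingUpperBoundAt_of_classX12_of_cmInert`) takes its Manin datum from Edixhoven 1991 Thm. 3
(`7 < p`); at `p ∈ {5, 7}` the census of record (k8i-c2 g2/g3, U57) called the class-level datum
«Manin-conjecture-bound» (Stevens' `X₁`-transfer costs the Mazur-torsion primes; Cremona is per pair).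

THE ARGUMENT (G. Stevens, Invent. Math. 98 (1989) §5, Thm. 5.1 / Lemma 5.2 / Lemma 5.4, pp. 96–99,
read FIRST-HAND from the GDZ scan PPN356556735_0098 LOG_0011; there for `X₁(N)`-lattices modulo his
Conjecture I″, here rerun `p`-LOCALLY with `X₀(N)`-lattices, where no conjecture is needed). `W/ℚ`
globally minimal of conductor `N`, `p` odd, `V/ℚ` globally minimal GOOD at `p` with `C • W^{(p*)} = V`,
`W` additive at `p`, `W[p]`, `V[p]` irreducible; `f_W, f_V` the newforms, `Λ_f = periodLattice f`,
`τ² = p*`: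
* `τ·Λ_{f_W} ⊆ Λ_{f_V}` — the sibling file `…TwistPeriodLattice` (Stevens' Lemma 5.4 at `Γ₀`), the
  levels being `N = N_V p²` (`conductorNorm_eq_of_cuspCoeff_eq_twist`, Atkin–Lehner) and
  `aₙ(f_W) = (n/p) aₙ(f_V)` (`cuspCoeff_eq_legendreSym_mul_cuspCoeff`);
* `Λ(W₀) = c_W Λ_{f_W}` for the `X₀(N)`-OPTIMAL `W₀ ∼ W` (Modularity + Edixhoven's integrality, tree
  theorem `exists_optimal_modularParametrizationData_of_modularity`);
* `c_V Λ_{f_V} ⊆ Λ(V₀)` for the optimal `V₀ ∼ V`, with `p ∤ c_V` by **Mazur 1978 Cor. 4.1** at the GOOD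
  prime `p ∤ N_V` (named fact `mazur_not_dvd_maninConstant_of_odd`, hypothesis `hMaz`);
* `Λ(V) = u·τ⁻¹·Λ(W)` (Stevens' Lemma 5.2 in lattice form: `IsNeronLatticeOf.smul` and `τ² = p*`), with
  `ord_p u ≥ 1` from `Δ(V) = u⁻¹² p*⁶ Δ(W)`, `p ∤ Δ_min(V)` (`one_le_padicValRat_u_of_twist_good`);
* `p`-unit integral multipliers `k₁ : Λ(V₀) → Λ(V)`, `k₂ : Λ(W) → Λ(W₀)` (tree
  `X11b.exists_int_mul_mem_lattice_not_dvd`: Néron mapping property + `E[p]` irreducible ⇒ a cyclic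
  `ℚ`-isogeny of degree prime to `p`);
so `(k₂ k₁ c_V p* / (u c_W))·Λ(W₀) ⊆ Λ(W₀)`, an integer (`int_of_rat_mul_mem_lattice_self`), and
`ord_p c_W ≤ 1 − ord_p u ≤ 0` (`not_dvd_of_mul_eq`): **`p ∤ c_W`**, transported to `W` as the datum
`(f_W, Λ(W), k·c_W)` — `exists_modularParametrizationData_not_dvd_of_twist_good`. No Edixhoven, no
`p > 7`, no table, no CM hypothesis.

HONEST LABEL: theorems only (no `def`, no named fact minted, no `sorry`); CONDITIONAL on the named facts
`hnf` (Modularity) and `hMaz` (Mazur 1978 Cor. 4.1, printed proof, not formalised); the crux 19223,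
STEP L and O10 stay OPEN; BSD is not proved for any curve here; nothing booked.

References: G. Stevens, Invent. Math. 98 (1989) §5; B. Mazur, Invent. Math. 44 (1978) Cor. 4.1;
J. H. Silverman, AEC III.1, VII.1, ATAEC IV.5–IV.9; A. Agashe, K. Ribet, W. Stein, PAMQ 2 (2006) §2;
B. Edixhoven, Progr. Math. 89 (1991) Prop. 2, Thm. 3; A. O. L. Atkin, J. Lehner, Math. Ann. 185 (1970) §6.
-/

set_option autoImplicit false
set_option linter.dupNamespace false

noncomputable section

open scoped Classical MatrixGroups ModularForm NumberField

open CongruenceSubgroup Field WeierstrassCurve NumberField IsDedekindDomain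
open Literature.NumberTheory.EllipticCurves
open Literature.NumberTheory.EllipticCurves.ModularForms
open Literature.NumberTheory.EllipticCurves.Rank1Residual
open Literature.NumberTheory.Automorphic
open Summit.BirchSwinnertonDyer.Rank1Residual

namespace Summit.BirchSwinnertonDyer.BirchSwinnertonDyer.Theorems.CccOneManinTwist

/-! ## The Manin constant of the optimal `p*`-twist of a curve good at `p` is prime to `p` -/

section Manin

/-- **Valuation bookkeeping** for the lattice chain of §2: if an integer `K` satisfies
`K·u·c_W = k₂·k₁·c_V·d` with `p ∤ k₁ k₂ c_V`, `ord_p d = 1`, `ord_p u ≥ 1`, then `p ∤ c_W`.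
[folklore] -/
theorem not_dvd_of_mul_eq {p : ℕ} [hp : Fact p.Prime] {K k₁ k₂ cV cW : ℤ} {u d : ℚ}
    (hk₁ : ¬ (p : ℤ) ∣ k₁) (hk₂ : ¬ (p : ℤ) ∣ k₂) (hcV : ¬ (p : ℤ) ∣ cV)
    (hu0 : u ≠ 0) (hu : 1 ≤ padicValRat p u) (hd0 : d ≠ 0) (hd : padicValRat p d = 1)
    (hK : (K : ℚ) * (u * cW) = k₂ * k₁ * cV * d) : ¬ (p : ℤ) ∣ cW := by
  intro hpc
  have hk₁0 : (k₁ : ℚ) ≠ 0 := by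
    exact_mod_cast (show k₁ ≠ 0 from fun h ↦ hk₁ (h ▸ dvd_zero (p : ℤ)))
  have hk₂0 : (k₂ : ℚ) ≠ 0 := by
    exact_mod_cast (show k₂ ≠ 0 from fun h ↦ hk₂ (h ▸ dvd_zero (p : ℤ)))
  have hcV0 : (cV : ℚ) ≠ 0 := by
    exact_mod_cast (show cV ≠ 0 from fun h ↦ hcV (h ▸ dvd_zero (p : ℤ)))
  have hR : (k₂ : ℚ) * k₁ * cV * d ≠ 0 :=
    mul_ne_zero (mul_ne_zero (mul_ne_zero hk₂0 hk₁0) hcV0) hd0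
  have hcW0 : (cW : ℚ) ≠ 0 := by
    intro h
    rw [h, mul_zero, mul_zero] at hK
    exact hR hK.symm
  have hK0 : (K : ℚ) ≠ 0 := by
    intro h
    rw [h, zero_mul] at hK
    exact hR hK.symm
  have hv := congrArg (padicValRat p) hK
  rw [padicValRat.mul hK0 (mul_ne_zero hu0 hcW0), padicValRat.mul hu0 hcW0,
    padicValRat.mul (mul_ne_zero (mul_ne_zero hk₂0 hk₁0) hcV0) hd0,
    padicValRat.mul (mul_ne_zero hk₂0 hk₁0) hcV0, padicValRat.mul hk₂0 hk₁0, hd,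
    padicValRat.of_int, padicValRat.of_int, padicValRat.of_int, padicValRat.of_int,
    padicValRat.of_int, padicValInt.eq_zero_of_not_dvd hk₁, padicValInt.eq_zero_of_not_dvd hk₂,
    padicValInt.eq_zero_of_not_dvd hcV] at hv
  have hKv : (0 : ℤ) ≤ padicValInt p K := by positivity
  have hcWv : 1 ≤ padicValInt p cW := by
    rcases (padicValInt_dvd_iff 1 cW).mp (by rwa [pow_one]) with h | h
    · exact absurd (show (cW : ℚ) = 0 by exact_mod_cast h) hcW0
    · exact h
  have h1 : (1 : ℤ) ≤ (padicValInt p cW : ℤ) := by exact_mod_cast hcWv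
  push_cast at hv
  linarith

/-- **`ord_p u(C) ≥ 1` for the change of variables `C • W^{(p*)} = V` from the `p*`-twist of a
globally minimal `W` to a globally minimal `V` GOOD at `p`**: `Δ(V) = u⁻¹² · p*⁶ · Δ(W)` (Mathlib
`variableChange_Δ`, the tree's `quadraticTwist_Δ`), `p ∤ Δ_min(V)` (good reduction) and
`Δ_min(W) ∈ ℤ`, so `12·ord_p u = 6 + ord_p Δ(W) ≥ 6`. (The exact value is `1`: `ord_p Δ(W) = 6`,
Kodaira `I₀*`; only the inequality is used.) [cite: SilvermanAEC2009, III.1 Table 3.1 and VII.1] -/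
theorem one_le_padicValRat_u_of_twist_good {p : ℕ} [hp : Fact p.Prime]
    (W : WeierstrassCurve ℚ) [W.IsElliptic] [W.IsGloballyMinimal]
    (V : WeierstrassCurve ℚ) [V.IsElliptic] [V.IsGloballyMinimal] (C : VariableChange ℚ)
    (hCV : C • W.quadraticTwist ((-1) ^ (p / 2) * p) = V) (hgood : V.HasGoodReductionAtPrime p) :
    1 ≤ padicValRat p (C.u : ℚ) := by
  have hpP := hp.out
  have hΔ : V.Δ = ((C.u : ℚ)⁻¹) ^ 12 * (((-1 : ℚ) ^ (p / 2) * p) ^ 6 * W.Δ) := by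
    rw [← hCV, variableChange_Δ, quadraticTwist_Δ, Units.val_inv_eq_inv_val]
  have hVΔ : padicValRat p V.Δ = 0 := by
    rw [← V.cast_minimalDiscriminantInt, padicValRat.of_int,
      padicValInt.eq_zero_of_not_dvd (V.not_dvd_minimalDiscriminantInt_of_hasGoodReductionAtPrime' p hgood)]
    rfl
  have hWΔ : 0 ≤ padicValRat p W.Δ := by
    rw [← W.cast_minimalDiscriminantInt, padicValRat.of_int]; positivity
  have hW0 : W.Δ ≠ 0 := by rw [← coe_Δ']; exact W.Δ'.ne_zero
  have hu0 : (C.u : ℚ) ≠ 0 := C.u.ne_zero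
  have hm1 : ((-1 : ℚ) ^ (p / 2)) ≠ 0 := pow_ne_zero _ (by norm_num)
  have hpQ : (p : ℚ) ≠ 0 := Nat.cast_ne_zero.mpr hpP.ne_zero
  have hd0 : ((-1 : ℚ) ^ (p / 2) * p) ≠ 0 := mul_ne_zero hm1 hpQ
  have hdv : padicValRat p ((-1 : ℚ) ^ (p / 2) * p) = 1 := by
    rw [padicValRat.mul hm1 hpQ, padicValRat.pow, padicValRat.neg, padicValRat.one, mul_zero,
      zero_add, padicValRat.self hpP.one_lt]
  have hv := congrArg (padicValRat p) hΔ
  rw [hVΔ, padicValRat.mul (pow_ne_zero _ (inv_ne_zero hu0)) (mul_ne_zero (pow_ne_zero _ hd0) hW0),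
    padicValRat.mul (pow_ne_zero _ hd0) hW0, padicValRat.pow, padicValRat.pow, padicValRat.inv,
    hdv] at hv
  push_cast at hv
  -- `0 = 12 * (-v u) + (6 + v Δ_W)`; `v u` is an integer multiple... `padicValRat` is `ℤ`-valued
  have key : 12 * padicValRat p (C.u : ℚ) = 6 + padicValRat p W.Δ := by linarith
  have h6 : (6 : ℤ) ≤ 12 * padicValRat p (C.u : ℚ) := by rw [key]; linarith
  omega

/-- **THE MANIN CONSTANT OF A `p*`-TWIST CLASS IS PRIME TO `p` (Stevens 1989 §5 run `p`-locally at
level `Γ₀`; Mazur 1978 Cor. 4.1 at the GOOD prime of the twin).** Let `W/ℚ` be globally minimal of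
conductor `N`, `p` an odd prime, `V/ℚ` globally minimal with GOOD reduction at `p` and
`C • W^{(p*)} = V` (`p* = (−1)^{(p−1)/2} p`), `W` additive at the place `v` over `p`, and `W[p]`,
`V[p]` irreducible. Then `W` admits a modular parametrisation datum at level `N` whose Manin constant
is prime to `p`: `∃ Dt, p ∤ c(Dt)`. Proof (module docstring): `τ·Λ_{f_W} ⊆ Λ_{f_V}` (§1, the
level being `N = N_V p²` by `conductorNorm_eq_of_cuspCoeff_eq_twist`); `Λ(W₀) = c_W Λ_{f_W}` for the
`X₀(N)`-optimal `W₀ ∼ W` (`exists_optimal_modularParametrizationData_of_modularity`, Edixhoven's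
integrality being a tree theorem); `c_V Λ_{f_V} ⊆ Λ(V₀)` with `p ∤ c_V` (`hMaz` at `p ∤ N_V`);
`Λ(V) = u τ⁻¹ Λ(W)` (`IsNeronLatticeOf.smul`, `τ² = p*`) with `ord_p u ≥ 1`
(`one_le_padicValRat_u_of_twist_good`); `p`-unit integral multipliers `Λ(V₀) → Λ(V)`, `Λ(W) → Λ(W₀)`
(`X11b.exists_int_mul_mem_lattice_not_dvd`); so `(k₂k₁c_V p*/(u c_W))·Λ(W₀) ⊆ Λ(W₀)`, an integer
(`int_of_rat_mul_mem_lattice_self`), and `not_dvd_of_mul_eq` gives `p ∤ c_W`; finally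
`(f_W, Λ(W), k c_W)` with `p ∤ k` is the datum of `W` (`ModularParametrizationData.exists_of_isNewformOf`).
CONDITIONAL on the named facts `hnf` (Modularity) and `hMaz` (Mazur 1978 Cor. 4.1); nothing booked.
[cite: Mazur1978, Cor. 4.1] [cite: Shimura1971, Prop. 3.64]
[cite: SilvermanATAEC1994, IV.5.1 with IV.6.1 and Cor. IV.9.1] [cite: AgasheRibetStein2006, §§1–2] -/
theorem exists_modularParametrizationData_not_dvd_of_twist_good (hnf : exists_isNewformOf)
    (hMaz : mazur_not_dvd_maninConstant_of_odd)
    (W : WeierstrassCurve ℚ) [W.IsElliptic] [W.IsGloballyMinimal] {N : ℕ} [NeZero N]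
    (hN : W.conductorNorm ℤ = N) (p : ℕ) [hp : Fact p.Prime] (hp2 : p ≠ 2)
    {v : HeightOneSpectrum (𝓞 ℚ)} (hv : (Rat.HeightOneSpectrum.primesEquiv v : ℕ) = p)
    (hadd : W.HasAdditiveReductionAt v)
    (V : WeierstrassCurve ℚ) [V.IsElliptic] [V.IsGloballyMinimal] (C : VariableChange ℚ)
    (hCV : C • W.quadraticTwist ((-1) ^ (p / 2) * p) = V) (hgood : V.HasGoodReductionAtPrime p)
    (hirrW : W.HasIrreducibleModPGaloisRep p) (hirrV : V.HasIrreducibleModPGaloisRep p) :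
    ∃ Dt : ModularParametrizationData W N, ¬ (p : ℤ) ∣ Dt.c := by
  have hpP : p.Prime := hp.out
  haveI : NeZero p := ⟨hpP.ne_zero⟩
  have hNS := integral_neronScaling_of_isGloballyMinimal_holds
  set d : ℚ := (-1) ^ (p / 2) * p with hd
  have hm1 : ((-1 : ℚ) ^ (p / 2)) ≠ 0 := pow_ne_zero _ (by norm_num)
  have hpQ : (p : ℚ) ≠ 0 := Nat.cast_ne_zero.mpr hpP.ne_zero
  have hd0 : d ≠ 0 := mul_ne_zero hm1 hpQ
  -- (a) the optimal curve `W₀ ∼ W` and its lattice-optimal datum `D₀` (`Λ(W₀) = c_W Λ_{f_W}`)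
  obtain ⟨W₀, hW₀, hW₀min, D₀, hfW, hisoW, hmin⟩ :=
    exists_optimal_modularParametrizationData_of_modularity hnf N W hN
  haveI := hW₀
  haveI := hW₀min
  obtain ⟨W₁, hW₁, D₁, hf₁, h₁⟩ := D₀.exists_optimalDatum'
  haveI := hW₁
  have hopt : ∀ z ∈ D₀.L.lattice, ∃ w ∈ periodLattice D₀.f, z = D₀.c * w :=
    D₀.latticeEq_of_modularDegree_le D₁ hf₁ h₁ (hmin W₁ D₁ hf₁)
  -- (b) the optimal curve `V₀ ∼ V`, its datum `DV`, and Mazur: `p ∤ c_V`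
  haveI : NeZero (V.conductorNorm ℤ) := ⟨(V.conductorNorm_pos_holds).ne'⟩
  obtain ⟨V₀, hV₀, hV₀min, DV, hfV, hisoV, hminV⟩ :=
    exists_optimal_modularParametrizationData_of_modularity hnf (V.conductorNorm ℤ) V rfl
  haveI := hV₀
  haveI := hV₀min
  obtain ⟨V₁, hV₁, DV₁, hfV₁, hV₁'⟩ := DV.exists_optimalDatum'
  haveI := hV₁
  have hoptV : ∀ z ∈ DV.L.lattice, ∃ w ∈ periodLattice DV.f, z = DV.c * w :=
    DV.latticeEq_of_modularDegree_le DV₁ hfV₁ hV₁' (hminV V₁ DV₁ hfV₁)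
  have hpNV : ¬ p ∣ V.conductorNorm ℤ := not_dvd_conductorNorm_of_hasGoodReductionAtPrime V hgood
  have hpNV2 : ¬ p ^ 2 ∣ V.conductorNorm ℤ := fun h ↦ hpNV ((Dvd.intro_left _ (sq p).symm).trans h)
  have hcV : ¬ (p : ℤ) ∣ DV.c := hMaz V₀ DV hoptV p hpP hp2 hpNV2
  -- (c) `q`-expansions: `aₙ(f_W) = (n/p) aₙ(f_V)`
  haveI : (W.quadraticTwist d).IsElliptic := W.isElliptic_quadraticTwist hd0
  have hfV' : IsNewformOf (W.quadraticTwist (((-1 : ℤ) ^ (p / 2) * p : ℤ) : ℚ)) DV.f := by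
    have hcast : (((-1 : ℤ) ^ (p / 2) * p : ℤ) : ℚ) = d := by rw [hd]; push_cast; rfl
    rw [hcast, ← isNewformOf_smul_iff C, hCV]
    exact hfV
  have hcoef : ∀ n, cuspCoeff D₀.f n = (legendreSym p n : ℂ) * cuspCoeff DV.f n :=
    W.cuspCoeff_eq_legendreSym_mul_cuspCoeff hp2 hv hadd hfW hfV'
  -- (d) the level: `N = N_V p²`
  have hχq := isQuadratic_quadraticChar_ringHomComp p
  have hprim := isPrimitive_quadraticChar_ringHomComp p hp2
  have hLco : ∀ n : ℕ, (W.LFunction n : ℂ) =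
      (quadraticChar (ZMod p)).ringHomComp (Int.castRingHom ℂ) n * (V.LFunction n : ℂ) := fun n ↦ by
    rw [← hfW.2 n, ← hfV.2 n, quadraticChar_ringHomComp_apply_natCast]
    exact hcoef n
  have hcop : (V.conductorNorm ℤ).Coprime p :=
    (Nat.Coprime.symm ((Nat.Prime.coprime_iff_not_dvd hpP).mpr hpNV))
  have hNeq : N = V.conductorNorm ℤ * p ^ 2 := by
    rw [← hN]
    exact conductorNorm_eq_of_cuspCoeff_eq_twist V hnf hcop hχq hprim W hLco
  -- (e) §1: `τ Λ_{f_W} ⊆ Λ_{f_V}`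
  set τ : ℂ := gaussSum ((quadraticChar (ZMod p)).ringHomComp (Int.castRingHom ℂ))
    (ZMod.stdAddChar (N := p)) with hτ
  have hΛ : ∀ z ∈ periodLattice D₀.f, τ * z ∈ periodLattice DV.f :=
    mul_mem_periodLattice_of_cuspCoeff_eq_legendreSym_mul DV.f hp2 hcoef
      (hNeq ▸ dvd_mul_right _ _) (hNeq ▸ dvd_mul_left _ _)
  -- (f) `τ² = p* = d`
  have hF : ringChar (ZMod p) ≠ 2 := by rwa [ZMod.ringChar_zmod_n]
  have hne : (quadraticChar (ZMod p)).ringHomComp (Int.castRingHom ℂ) ≠ 1 :=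
    (MulChar.ringHomComp_ne_one_iff (RingHom.injective_int _)).mpr (quadraticChar_ne_one hF)
  have hτ2 : τ ^ 2 = (d : ℂ) := by
    rw [hτ, gaussSum_sq hne ((quadraticChar_isQuadratic (ZMod p)).comp _)
      (ZMod.isPrimitive_stdAddChar p), MulChar.ringHomComp_apply, quadraticChar_neg_one hF, ZMod.card,
      eq_intCast, ZMod.χ₄_eq_neg_one_pow (Nat.odd_iff.mp (hpP.odd_of_ne_two hp2)), hd]
    push_cast
    ring
  have hdC : (d : ℂ) ≠ 0 := by exact_mod_cast hd0
  have hτ0 : τ ≠ 0 := fun h ↦ hdC (by rw [← hτ2, h, zero_pow two_ne_zero])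
  have hτi : τ⁻¹ ≠ 0 := inv_ne_zero hτ0
  -- (g) Néron lattices: `Λ(W)`, the twist `τ⁻¹ Λ(W)`, and `Λ(V) = u τ⁻¹ Λ(W)`
  obtain ⟨LW, hLW⟩ := exists_isNeronLatticeOf_holds (W.baseChange ℂ)
  have hL1 : IsNeronLatticeOf ((W.quadraticTwist d).baseChange ℂ) (LW.mulLeft τ⁻¹ hτi) := by
    obtain ⟨h2, h3⟩ := hLW
    have e4 : (τ⁻¹ ^ 4)⁻¹ = (d : ℂ) ^ 2 := by
      rw [inv_pow, inv_inv, show (4 : ℕ) = 2 * 2 from rfl, pow_mul, hτ2]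
    have e6 : (τ⁻¹ ^ 6)⁻¹ = (d : ℂ) ^ 3 := by
      rw [inv_pow, inv_inv, show (6 : ℕ) = 2 * 3 from rfl, pow_mul, hτ2]
    refine ⟨?_, ?_⟩
    · rw [PeriodPair.g₂_mulLeft, h2, e4, WeierstrassCurve.baseChange, WeierstrassCurve.baseChange,
        map_c₄, map_c₄, quadraticTwist_c₄, map_mul, map_pow]
      simp only [eq_ratCast]
      ring
    · rw [PeriodPair.g₃_mulLeft, h3, e6, WeierstrassCurve.baseChange, WeierstrassCurve.baseChange,
        map_c₆, map_c₆, quadraticTwist_c₆, map_mul, map_pow]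
      simp only [eq_ratCast]
      ring
  obtain ⟨LV, hLV⟩ := exists_isNeronLatticeOf_holds (V.baseChange ℂ)
  have hLV' : IsNeronLatticeOf ((C • W.quadraticTwist d).baseChange ℂ) LV := by rw [hCV]; exact hLV
  have hLVeq := IsNeronLatticeOf.lattice_eq_mulLeft_of_smul C hL1 hLV'
  have hu0 : (C.u : ℚ) ≠ 0 := C.u.ne_zero
  have huC : ((C.u : ℚ) : ℂ) ≠ 0 := by exact_mod_cast hu0
  have hVW : ∀ x ∈ LV.lattice, τ * ((((C.u : ℚ) : ℂ))⁻¹ * x) ∈ LW.lattice := by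
    intro x hx
    rw [hLVeq, PeriodPair.mem_mulLeft_lattice, PeriodPair.mem_mulLeft_lattice, inv_inv] at hx
    exact hx
  -- (h) `p`-unit integral multipliers `k₁ : Λ(V₀) → Λ(V)` and `k₂ : Λ(W) → Λ(W₀)`
  obtain ⟨k₁, hk₁0, hpk₁, hk₁⟩ := X11b.exists_int_mul_mem_lattice_not_dvd hNS hisoV.symm_of_charZero
    DV.isNeronLattice hLV hpP hirrV
  have hirrW₀ : W₀.HasIrreducibleModPGaloisRep p := by
    by_contra h
    exact not_hasIrreducibleModPGaloisRep_of_isIsogenous hisoW.symm_of_charZero h hirrW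
  obtain ⟨k₂, hk₂0, hpk₂, hk₂⟩ := X11b.exists_int_mul_mem_lattice_not_dvd hNS hisoW hLW
    D₀.isNeronLattice hpP hirrW₀
  -- (i) the chain: `ρ Λ(W₀) ⊆ Λ(W₀)` with `ρ = k₂ k₁ c_V d / (u c_W)`
  set ρ : ℚ := (k₂ * k₁ * DV.c : ℤ) * d / ((C.u : ℚ) * D₀.c) with hρ
  have hcW0 : (D₀.c : ℚ) ≠ 0 := by exact_mod_cast D₀.maninConstant_ne_zero_holds
  have hchain : ∀ z ∈ D₀.L.lattice, (ρ : ℂ) * z ∈ D₀.L.lattice := by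
    intro z hz
    obtain ⟨w, hw, rfl⟩ := hopt z hz
    have h5 := hk₂ _ (hVW _ (hk₁ _ (DV.smul_periodLattice_le _ (hΛ w hw))))
    have heq : (ρ : ℂ) * ((D₀.c : ℂ) * w) =
        (k₂ : ℂ) * (τ * ((((C.u : ℚ) : ℂ))⁻¹ * ((k₁ : ℂ) * ((DV.c : ℂ) * (τ * w))))) := by
      have hcWC : ((D₀.c : ℤ) : ℂ) ≠ 0 := by exact_mod_cast D₀.maninConstant_ne_zero_holds
      rw [hρ]
      push_cast
      field_simp
      rw [← hτ2]
      ring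
    rw [heq]
    exact h5
  obtain ⟨K, hK⟩ := int_of_rat_mul_mem_lattice_self D₀.L ρ hchain
  -- (j) valuations: `p ∤ c_W`
  have hdv : padicValRat p d = 1 := by
    rw [hd, padicValRat.mul hm1 hpQ, padicValRat.pow, padicValRat.neg, padicValRat.one, mul_zero,
      zero_add, padicValRat.self hpP.one_lt]
  have hc₀ : ¬ (p : ℤ) ∣ D₀.c := by
    refine not_dvd_of_mul_eq (K := K) hpk₁ hpk₂ hcV hu0
      (one_le_padicValRat_u_of_twist_good W V C hCV hgood) hd0 hdv ?_
    rw [hK, hρ]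
    push_cast
    field_simp
  -- (k) transport to `W`: the datum `(f_W, Λ(W), k c_W)` with `p ∤ k`
  obtain ⟨k, hk0, hpk, hk⟩ := X11b.exists_int_mul_mem_lattice_not_dvd hNS hisoW.symm_of_charZero
    D₀.isNeronLattice hLW hpP hirrW
  have hm0 : k * D₀.c ≠ 0 := mul_ne_zero hk0 D₀.maninConstant_ne_zero_holds
  have hle : ∀ z ∈ periodLattice D₀.f, ((k * D₀.c : ℤ) : ℂ) * z ∈ LW.lattice := fun z hz ↦ by
    have h2 := hk _ (D₀.smul_periodLattice_le z hz)
    rwa [← mul_assoc, ← Int.cast_mul] at h2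
  obtain ⟨D, -, -, hDc⟩ := ModularParametrizationData.exists_of_isNewformOf hfW hLW hm0 hle
  refine ⟨D, fun hdvd ↦ ?_⟩
  rw [hDc] at hdvd
  rcases (Nat.prime_iff_prime_int.mp hpP).dvd_or_dvd hdvd with h | h
  · exact hpk h
  · exact hc₀ h

end Manin

end Summit.BirchSwinnertonDyer.BirchSwinnertonDyer.Theorems.CccOneManinTwist

end
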